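import Summits.AtomisticToContinuum.Crystallization.Theorems.ThreeConeCertificateSlackRigidityPricedFloorsGlobalize4

/-!
# Globalisation of exact local layerings, V: propagation along a layer

Helper file for the stub `stub_globalize` of the line `priced-floors-palm-exactification`
(crux `ThreeConeCertificate.SlackRigidity`, item 11960): the exact local-to-global layer lemma
(Hales, *Dense Sphere Packings* §1.3, layer induction) for the admissible layered family of
item 13958.  This file: the in-plane step (Hales's propagation along a layer through the hexagon completion lemma) and the constancy of the first shell along a full layer by lattice induction.
-/

noncomputable section

open Set
open Literature.MathematicalPhysics.StatisticalMechanics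
open Summit.AtomisticToContinuum.Crystallization.Theorems.SlackRigidityPricedFloors

namespace Summit.AtomisticToContinuum.Crystallization.Theorems.SlackRigidityPricedFloorsGlobalize

variable {a : ℝ}

section Site

variable {S : Set E3}

/-- **In-plane step** (Hales's propagation along a layer, DSP §1.3, through the hexagon
completion lemma): if the shell of `q ∈ S` is not a regular cuboctahedron and contains the
hexagon `B (lat b '' hexCodes)`, then for each hexagon vector `η` the point `q + η` is in `S` and
has the same first shell as `q`. [cite: HalesDSP2012, §1.3] -/
theorem inplane_step (hS : ∀ y ∈ S, ExactLayeredAt S y) {q : E3} (hq : q ∈ S)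
    (hnreg : ¬ ((∀ θ ∈ nbr S q, -θ ∈ nbr S q) ∧ ∀ θ ∈ nbr S q, ∀ θ' ∈ nbr S q, ‖θ‖ = ‖θ'‖))
    {B : E3 ≃ₗᵢ[ℝ] E3} {b : ℝ} (hb : 0 < b) (hH : ∀ c ∈ hexCodes, B (lat b c) ∈ nbr S q)
    {c₀ : ℤ × ℤ} (hc₀ : c₀ ∈ hexCodes) :
    q + B (lat b c₀) ∈ S ∧ nbr S (q + B (lat b c₀)) = nbr S q := by
  obtain ⟨A, a, s, z, hadm, hz0, -, hE2, hN⟩ := site (hS q hq)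
  obtain ⟨ha1, ha2, hs, hz⟩ := hadm
  have ha0 : a ≠ 0 := by linarith
  obtain ⟨ht1, ht2, hzp, hzn⟩ := abs_heights_of_adm ⟨ha1, ha2, hs, hz⟩ hz0
  have hσ₁ : s 0 = 1 ∨ s 0 = -1 := hs 0
  have hσ₂ : -s (-1) = 1 ∨ -s (-1) = -1 := by rcases hs (-1) with h | h <;> omega
  have hz1 : z 1 ≠ 0 := hzp.ne'
  have hzm : z (-1) ≠ 0 := hzn.ne
  set N := shellSet a (s 0) (z 1) (-s (-1)) (z (-1)) with hNdef
  set η := B (lat b c₀) with hηdef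
  have hmem : ∀ θ ∈ nbr S q, A.symm θ ∈ N := by
    intro θ hθ
    rw [hN] at hθ
    obtain ⟨p, hp, rfl⟩ := hθ
    rw [A.symm_apply_apply]
    exact hp
  obtain ⟨hr1, hr2, hr3⟩ := rot_mem_hexCodes hc₀
  -- `η` is in-plane for the data at `q`
  have hηN : A.symm η ∈ N := hmem η (hH c₀ hc₀)
  have hηhex : A.symm η ∈ shellPart a hexCodes 0 := by
    by_contra hnot
    apply hnreg
    set ξ := B (lat b (rot c₀)) with hξdef
    have hξN : A.symm ξ ∈ N := hmem ξ (hH _ hr1)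
    have hη'N : -A.symm η ∈ N := by
      rw [← map_neg, hηdef, ← map_neg, ← lat_neg]
      exact hmem _ (hH _ (neg_mem_hexCodes hc₀))
    have hdN : A.symm η - A.symm ξ ∈ N := by
      rw [← map_sub, hηdef, hξdef, ← map_sub, ← lat_sub]
      exact hmem _ (hH _ hr2)
    have hn1 : ‖A.symm ξ‖ = ‖A.symm η‖ := by
      rw [A.symm.norm_map, A.symm.norm_map, hξdef, hηdef, norm_map_lat_hex B hb hr1,
        norm_map_lat_hex B hb hc₀]
    have hn2 : ‖A.symm η - A.symm ξ‖ = ‖A.symm η‖ := by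
      rw [← map_sub, A.symm.norm_map, A.symm.norm_map, hηdef, hξdef, ← map_sub, ← lat_sub,
        norm_map_lat_hex B hb hr2, norm_map_lat_hex B hb hc₀]
    obtain ⟨hcs1, hcs2, hid⟩ := csi_of_not_hex ha0 hσ₁ hσ₂ hz1 hzm hηN hη'N hξN hdN hn1 hn2 hnot
    have hsymN : ∀ v ∈ N, -v ∈ N := by
      intro v hv
      rw [hNdef, hcs1, hcs2] at hv ⊢
      exact neg_mem_shellSet_cs ha0 hσ₁ hv
    have hnoN : ∀ v ∈ N, ‖v‖ = a := by
      intro v hv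
      rw [hNdef, hcs1, hcs2] at hv
      exact norm_sq_of_csi (by linarith) hσ₁ hid hv
    constructor
    · intro θ hθ
      have h1 := hsymN _ (hmem θ hθ)
      rw [hN]
      exact ⟨-A.symm θ, h1, by simp⟩
    · intro θ hθ θ' hθ'
      rw [← A.symm.norm_map θ, ← A.symm.norm_map θ', hnoN _ (hmem θ hθ), hnoN _ (hmem θ' hθ')]
  obtain ⟨c₁, hc₁, hηc⟩ := exists_of_mem_shellPart hηhex
  rw [zero_smul, add_zero] at hηc
  obtain ⟨i₁, j₁, rfl⟩ := exists_eq_of_mem_hexCodes hc₁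
  have hηA : η = A (lat a (3 * i₁, 3 * j₁)) := by rw [← hηc, A.apply_symm_apply]
  -- (1) membership
  have hq' : q + η ∈ S := (hH c₀ hc₀).1
  -- (2) the other eleven shell points transfer to the shell of `q + η`
  have htrans : ∀ θ ∈ nbr S q, θ ≠ η → θ ∈ nbr S (q + η) := by
    intro θ hθ hne
    have hθN := hmem θ hθ
    obtain ⟨-, h0, hle⟩ := hθ
    refine ⟨?_, h0, hle⟩
    have hst : lat a (3 * i₁, 3 * j₁) + A.symm θ ∈ stdL a s z := by
      obtain ⟨m, i, j, hp⟩ := shellSet_subset_stdL hs hz0 hθN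
      rw [hp, lat_add_pt]
      exact pt_mem_stdL _ _ _ _ _ _
    have hnn : ‖lat a (3 * i₁, 3 * j₁) + A.symm θ‖ ≤ 9 / 5 := by
      refine norm_lat_add_le ⟨ha1, ha2⟩ hσ₁ hσ₂ ht1.2 ht2.2 hc₁ hθN ?_
      intro h
      apply hne
      rw [hηA, ← h, A.apply_symm_apply]
    have := hE2 _ hst hnn
    rwa [map_add, A.apply_symm_apply, ← hηA, ← add_assoc] at this
  -- (3) the sixth hexagon vertex, by completion in the frame of `q + η`
  have hηmem : η ∈ nbr S (q + η) := by
    obtain ⟨A', a', s', z', hadm', hz0', -, -, hN'⟩ := site (hS _ hq')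
    obtain ⟨ha1', ha2', hs', hz'⟩ := hadm'
    obtain ⟨-, -, hzp', hzn'⟩ := abs_heights_of_adm ⟨ha1', ha2', hs', hz'⟩ hz0'
    have hσ₁' : s' 0 = 1 ∨ s' 0 = -1 := hs' 0
    have hσ₂' : -s' (-1) = 1 ∨ -s' (-1) = -1 := by rcases hs' (-1) with h | h <;> omega
    set N' := shellSet a' (s' 0) (z' 1) (-s' (-1)) (z' (-1)) with hN'def
    have hmem' : ∀ θ ∈ nbr S q, θ ≠ η → A'.symm θ ∈ N' := by
      intro θ hθ hne
      have h1 := htrans θ hθ hne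
      rw [hN'] at h1
      obtain ⟨p, hp, hpe⟩ := h1
      rw [← hpe, A'.symm_apply_apply]
      exact hp
    obtain ⟨hne1, hne2, hne3, hne4, hne5⟩ := rot_ne hc₀
    have hBinj : ∀ c c' : ℤ × ℤ, B (lat b c) = B (lat b c') → c = c' := fun c c' h =>
      (lat_inj hb.ne').1 (B.injective h)
    set ξ := B (lat b (rot c₀)) with hξdef
    have k1 : A'.symm ξ ∈ N' := hmem' ξ (hH _ hr1) (fun h => hne1 (hBinj _ _ h))
    have k2 : -A'.symm ξ ∈ N' := by
      rw [← map_neg, hξdef, ← map_neg, ← lat_neg]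
      exact hmem' _ (hH _ (neg_mem_hexCodes hr1)) (fun h => hne2 (hBinj _ _ h))
    have k3 : A'.symm ξ - A'.symm η ∈ N' := by
      rw [← map_sub, hξdef, hηdef, ← map_sub, ← lat_sub]
      exact hmem' _ (hH _ hr3) (fun h => hne3 (hBinj _ _ h))
    have k4 : A'.symm η - A'.symm ξ ∈ N' := by
      rw [← map_sub, hξdef, hηdef, ← map_sub, ← lat_sub]
      exact hmem' _ (hH _ hr2) (fun h => hne4 (hBinj _ _ h))
    have k5 : -A'.symm η ∈ N' := by
      rw [← map_neg, hηdef, ← map_neg, ← lat_neg]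
      exact hmem' _ (hH _ (neg_mem_hexCodes hc₀)) (fun h => hne5 (hBinj _ _ h))
    have hη0 : A'.symm η ≠ 0 := by
      intro h
      have h1 := (hH c₀ hc₀).2.1
      rw [← hηdef, ← A'.symm.norm_map, h, norm_zero] at h1
      exact lt_irrefl _ h1
    have hηn : ‖A'.symm η‖ ≤ 28 / 25 := by rw [A'.symm.norm_map]; exact (hH c₀ hc₀).2.2
    have h1 := hex_completion ha1' hσ₁' hσ₂' hzp'.ne' hzn'.ne k1 k2 k3 k4 k5 hη0 hηn
    rw [hN']
    exact ⟨A'.symm η, h1, A'.apply_symm_apply η⟩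
  -- (4) equality by counting
  refine ⟨hq', nbr_eq_of_subset (hS q hq) (hS _ hq') fun θ hθ => ?_⟩
  by_cases h : θ = η
  · rw [h]; exact hηmem
  · exact htrans θ hθ h

/-- Induction over `ℤ²` from the four unit steps. [folklore] -/
theorem int2_induction {P : ℤ → ℤ → Prop} (h0 : P 0 0) (h1 : ∀ i j, P i j → P (i + 1) j)
    (h2 : ∀ i j, P i j → P (i - 1) j) (h3 : ∀ i j, P i j → P i (j + 1))
    (h4 : ∀ i j, P i j → P i (j - 1)) : ∀ i j, P i j := by
  have hi : ∀ i, P i 0 := by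
    intro i
    induction i using Int.induction_on with
    | zero => exact h0
    | succ i ih => exact h1 _ _ ih
    | pred i ih => exact h2 _ _ ih
  intro i j
  induction j using Int.induction_on with
  | zero => exact hi i
  | succ j ih => exact h3 _ _ ih
  | pred j ih => exact h4 _ _ ih

/-- **Constancy of the shell along a layer** (lattice induction on the in-plane step): from a
site `c ∈ S` whose shell is not a regular cuboctahedron and contains the hexagon of the frame
`(B, b)`, the whole layer `c + B (lat b (3ℤ × 3ℤ))` lies in `S` with the same shell.
[cite: HalesDSP2012, §1.3] -/
theorem layer_const (hS : ∀ y ∈ S, ExactLayeredAt S y) {c : E3} (hc : c ∈ S)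
    (hnreg : ¬ ((∀ θ ∈ nbr S c, -θ ∈ nbr S c) ∧ ∀ θ ∈ nbr S c, ∀ θ' ∈ nbr S c, ‖θ‖ = ‖θ'‖))
    {B : E3 ≃ₗᵢ[ℝ] E3} {b : ℝ} (hb : 0 < b) (hH : ∀ c' ∈ hexCodes, B (lat b c') ∈ nbr S c) :
    ∀ i j : ℤ, c + B (lat b (3 * i, 3 * j)) ∈ S ∧ nbr S (c + B (lat b (3 * i, 3 * j))) = nbr S c := by
  have step : ∀ (i j : ℤ) (c₀ : ℤ × ℤ), c₀ ∈ hexCodes →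
      (c + B (lat b (3 * i, 3 * j)) ∈ S ∧ nbr S (c + B (lat b (3 * i, 3 * j))) = nbr S c) →
      (c + B (lat b ((3 * i, 3 * j) + c₀)) ∈ S ∧
        nbr S (c + B (lat b ((3 * i, 3 * j) + c₀))) = nbr S c) := by
    intro i j c₀ hc₀ ⟨hq, hN⟩
    have h := inplane_step hS hq (by rw [hN]; exact hnreg) hb (by rw [hN]; exact hH) hc₀
    rw [hN, add_assoc, ← map_add, ← lat_add] at h
    exact h
  apply int2_induction
  · exact ⟨by simpa using hc, by simp⟩
  · intro i j h
    have := step i j (3, 0) mem_hexCodes_basic.1 h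
    rwa [show ((3 * i, 3 * j) : ℤ × ℤ) + (3, 0) = (3 * (i + 1), 3 * j) by ext <;> simp; ring] at this
  · intro i j h
    have := step i j (-3, 0) mem_hexCodes_basic.2.1 h
    rwa [show ((3 * i, 3 * j) : ℤ × ℤ) + (-3, 0) = (3 * (i - 1), 3 * j) by ext <;> simp; ring] at this
  · intro i j h
    have := step i j (0, 3) mem_hexCodes_basic.2.2.1 h
    rwa [show ((3 * i, 3 * j) : ℤ × ℤ) + (0, 3) = (3 * i, 3 * (j + 1)) by ext <;> simp; ring] at this
  · intro i j h
    have := step i j (0, -3) mem_hexCodes_basic.2.2.2.1 h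
    rwa [show ((3 * i, 3 * j) : ℤ × ℤ) + (0, -3) = (3 * i, 3 * (j - 1)) by ext <;> simp; ring] at this

end Site

/-- **Main statement of this file** (registered sub-goal `globalize_layer_const`). [folklore] -/
theorem globalize_layer_const : ∀ (S : Set E3), (∀ y ∈ S, ExactLayeredAt S y) → ∀ (c : E3), c ∈ S → ¬ ((∀ θ ∈ nbr S c, -θ ∈ nbr S c) ∧ ∀ θ ∈ nbr S c, ∀ θ' ∈ nbr S c, ‖θ‖ = ‖θ'‖) → ∀ (B : E3 ≃ₗᵢ[ℝ] E3) (b : ℝ), 0 < b → (∀ c' ∈ hexCodes, B (lat b c') ∈ nbr S c) → ∀ i j : ℤ, c + B (lat b (3 * i, 3 * j)) ∈ S ∧ nbr S (c + B (lat b (3 * i, 3 * j))) = nbr S c :=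
  fun _ hS _ hc hnreg _ _ hb hH => layer_const hS hc hnreg hb hH

end Summit.AtomisticToContinuum.Crystallization.Theorems.SlackRigidityPricedFloorsGlobalize

end
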